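import Summits.ValiantsHypothesis.ValiantsHypothesis.Theorems.GrenetZeonDualUnipotentThreeHalvesLongMassCornerPrice

/-!
# `GrenetZeon.DualUnipotentThreeHalves` (stmt-ValiantsHypothesis-24318), line `slow_core`, stub (c) `SlowCore.LongMassSlowLawInv`:
# COMPRESSION TO AN INVARIANT CORNER IS CHEAPER — the `√2·√n·s` floor for every nil space whose invariant-block compression is a full `𝔫_s`

✓ `…LongMassCornerPrice` prices PLACED triangular corners `Ψ_σ(𝔫_s) ≤ V` from below.  The fat species of the cell rarely CONTAIN a placed `𝔫_s` — their
triangular bulk is coupled to other blocks (e.g. the Lagrangian Borel parts `[[A, B], [0, −JAᵀJ]]` of the all-`P` designs, `S₃(m)`, `U^{hi}`) — but they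
COMPRESS onto one: the coordinates `S = σ(Fin s)` span an invariant subspace (`A_{ij} = 0` for `i ∉ S`, `j ∈ S`) and the corner `A|_{S×S}` runs through
ALL of `𝔫_s`.  Compression along an invariant block is a homomorphism on powers, so window pairs push forward at no extra cost:

* `codim_map_le_of_le` — for a linear `Φ` and `W ≤ V`: `dim Φ(V) − dim Φ(W) ≤ dim V − dim W`.
* `submatrix_pow_apply_of_invariant` — if `M_{ij} = 0` for `i ∉ S`, `j ∈ S` then `((M|_{S×S})^p)_{ac} = (M^p)_{σ a, σ c}`.
* ★★★ `two_mul_sq_le_of_window_invariantCorner` — if `S = σ(Fin s)` is `V`-invariant (`s ≤ n`), the compression `V|_{S×S}` is strictly upper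
  triangular and exhausts `𝔫_s`, then EVERY window pair `(W, k)` of `V` costs `P = n·k + (dim V − dim W)` with `(P + n + 2s)² ≥ 2·n·s²`.

USE (lower-bound row for the census, by name): a species with an invariant coordinate block carrying a free triangular `s × s` compression costs
`≥ √2·√n·s − n − 2s`, whatever couples the block to the rest (conjugates via ✓ `price_conj_submodule`).
HONEST FRAMING.  Calibration instrument (`--supports stmt-ValiantsHypothesis-24318`); (c) `LongMassSlowLawInv` (∃ c) is RESEARCH — OPEN; closes no
stub; S3, 24318, 8062 (`stub_dualUnipotent`) and `VP ≠ VNP` are NOT proved.  Def-free, no named facts, no sorry.  [folklore]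
-/

set_option linter.dupNamespace false
set_option autoImplicit false

noncomputable section

namespace Summit.ValiantsHypothesis.ValiantsHypothesis.Theorems.GrenetZeon.FreeTriangularPrice

open MvPolynomial Matrix
open scoped BigOperators

variable {n b s : ℕ}

/-! ## §1 Two pieces of bookkeeping -/

/-- For a linear map `Φ` and sub-spaces `W ≤ V`: `dim Φ(V) − dim Φ(W) ≤ dim V − dim W` (rank–nullity twice; the kernel of `Φ|_W` sits in that of `Φ|_V`). -/
theorem codim_map_le_of_le (Φ : Matrix (Fin b) (Fin b) ℂ →ₗ[ℂ] Matrix (Fin s) (Fin s) ℂ) (V W : Submodule ℂ (Matrix (Fin b) (Fin b) ℂ))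
    (hWV : W ≤ V) :
    Module.finrank ℂ (V.map Φ) - Module.finrank ℂ (W.map Φ) ≤ Module.finrank ℂ V - Module.finrank ℂ W := by
  have h1 := LinearMap.finrank_range_add_finrank_ker (Φ ∘ₗ V.subtype)
  have h2 := LinearMap.finrank_range_add_finrank_ker (Φ ∘ₗ W.subtype)
  have hrV : LinearMap.range (Φ ∘ₗ V.subtype) = V.map Φ := by rw [LinearMap.range_comp, Submodule.range_subtype]
  have hrW : LinearMap.range (Φ ∘ₗ W.subtype) = W.map Φ := by rw [LinearMap.range_comp, Submodule.range_subtype]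
  have hker : Module.finrank ℂ (LinearMap.ker (Φ ∘ₗ W.subtype)) ≤ Module.finrank ℂ (LinearMap.ker (Φ ∘ₗ V.subtype)) := by
    let f : LinearMap.ker (Φ ∘ₗ W.subtype) →ₗ[ℂ] LinearMap.ker (Φ ∘ₗ V.subtype) :=
      { toFun := fun w => ⟨⟨(w.1 : Matrix (Fin b) (Fin b) ℂ), hWV w.1.2⟩, by
          have hw := w.2
          rw [LinearMap.mem_ker, LinearMap.comp_apply] at hw
          rw [LinearMap.mem_ker, LinearMap.comp_apply]; exact hw⟩
        map_add' := fun _ _ => rfl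
        map_smul' := fun _ _ => rfl }
    have hf : Function.Injective f := by
      intro x y hxy
      have h := congrArg (fun z : LinearMap.ker (Φ ∘ₗ V.subtype) => ((z : V) : Matrix (Fin b) (Fin b) ℂ)) hxy
      exact Subtype.ext (Subtype.ext h)
    exact LinearMap.finrank_le_finrank_of_injective hf
  rw [hrV] at h1
  rw [hrW] at h2
  have hWle : Module.finrank ℂ W ≤ Module.finrank ℂ V := Submodule.finrank_mono hWV
  omega

/-- Compression to an invariant coordinate block is a homomorphism on powers: if `M_{ij} = 0` whenever `i ∉ σ(Fin s) ∋ j`, then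
`((M|_{σ×σ})^p)_{ac} = (M^p)_{σ a, σ c}`. -/
theorem submatrix_pow_apply_of_invariant {R : Type*} [CommSemiring R] (σ : Fin s → Fin b) (hσ : Function.Injective σ)
    (M : Matrix (Fin b) (Fin b) R) (hinv : ∀ i j, (∀ a, σ a ≠ i) → (∃ c, σ c = j) → M i j = 0) :
    ∀ (p : ℕ) (a c : Fin s), ((M.submatrix σ σ) ^ p) a c = (M ^ p) (σ a) (σ c) := by
  classical
  intro p
  induction p with
  | zero => intro a c; simp only [pow_zero, Matrix.one_apply, hσ.eq_iff]
  | succ p ih =>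
    intro a c
    rw [pow_succ, pow_succ, Matrix.mul_apply, Matrix.mul_apply,
      sum_eq_sum_image_of_support σ hσ _ (fun q hq => by rw [hinv q (σ c) hq ⟨c, rfl⟩, mul_zero])]
    refine Finset.sum_congr rfl fun a' _ => ?_
    rw [ih a a', Matrix.submatrix_apply]

/-! ## §2 The invariant-corner price -/

/-- ★★★ **COMPRESSION TO AN INVARIANT CORNER IS CHEAPER; `𝔫_s`-CORNERS COST `√2·√n·s`.**  Let `σ : Fin s → Fin b` be injective (`s ≤ n`) and
`V ≤ M_b(ℂ)` such that `S = σ(Fin s)` is invariant (`A_{ij} = 0` for `i ∉ S ∋ j`, all `A ∈ V`), the compressions `A|_{S×S}` are strictly upper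
triangular, and every strictly upper `s × s` matrix is such a compression.  Then every window pair `(W, k)` of `V` costs `P = n·k + (dim V − dim W)`
with `(P + n + 2s)² ≥ 2·n·s²`. -/
theorem two_mul_sq_le_of_window_invariantCorner (hsn : s ≤ n) (σ : Fin s → Fin b) (hσ : Function.Injective σ)
    (V : Submodule ℂ (Matrix (Fin b) (Fin b) ℂ))
    (hinv : ∀ A ∈ V, ∀ i j, (∀ a, σ a ≠ i) → (∃ c, σ c = j) → A i j = 0)
    (hup : ∀ A ∈ V, ∀ a c : Fin s, ¬ a < c → A (σ a) (σ c) = 0)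
    (hfull : ∀ M : Matrix (Fin s) (Fin s) ℂ, (∀ a c, ¬ a < c → M a c = 0) → ∃ A ∈ V, A.submatrix σ σ = M)
    (W : Submodule ℂ (Matrix (Fin b) (Fin b) ℂ)) (k : ℕ) (hWV : W ≤ V)
    (hwin : ∀ A ∈ V, ∀ w ∈ W, ∀ p : ℕ, p ≤ n - 1 → ∀ i j : Fin b,
      (((A.map (C : ℂ → MvPolynomial (Fin 1) ℂ) + (X 0 : MvPolynomial (Fin 1) ℂ) • w.map C) ^ p :
        Matrix (Fin b) (Fin b) (MvPolynomial (Fin 1) ℂ)) i j).totalDegree ≤ k) :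
    2 * n * (s * s) ≤ (n * k + (Module.finrank ℂ V - Module.finrank ℂ W) + n + 2 * s) ^ 2 := by
  classical
  -- the compression map
  set Φ : Matrix (Fin b) (Fin b) ℂ →ₗ[ℂ] Matrix (Fin s) (Fin s) ℂ :=
    { toFun := fun A => A.submatrix σ σ
      map_add' := fun A B => by rw [Matrix.submatrix_add]; rfl
      map_smul' := fun t A => by rw [Matrix.submatrix_smul]; rfl } with hΦ
  have hΦapp : ∀ A, Φ A = A.submatrix σ σ := fun A => rfl
  set Vs := V.map Φ with hVs
  set Ws := W.map Φ with hWs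
  have hVs_iff : ∀ M : Matrix (Fin s) (Fin s) ℂ, M ∈ Vs ↔ ∀ a c, ¬ a < c → M a c = 0 := by
    intro M
    constructor
    · intro hM a c hac
      obtain ⟨A, hA, rfl⟩ := Submodule.mem_map.mp hM
      rw [hΦapp, Matrix.submatrix_apply]
      exact hup A hA a c hac
    · intro hM
      obtain ⟨A, hA, hAM⟩ := hfull M hM
      exact Submodule.mem_map.mpr ⟨A, hA, by rw [hΦapp, hAM]⟩
  have hWsVs : Ws ≤ Vs := Submodule.map_mono hWV
  -- window pairs push forward along the compression
  have hwin_s : ∀ A' ∈ Vs, ∀ w' ∈ Ws, ∀ p : ℕ, p ≤ n - 1 → ∀ a c : Fin s,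
      (((A'.map (C : ℂ → MvPolynomial (Fin 1) ℂ) + (X 0 : MvPolynomial (Fin 1) ℂ) • w'.map C) ^ p :
        Matrix (Fin s) (Fin s) (MvPolynomial (Fin 1) ℂ)) a c).totalDegree ≤ k := by
    intro A' hA' w' hw' p hp a c
    obtain ⟨A, hA, rfl⟩ := Submodule.mem_map.mp hA'
    obtain ⟨w, hw, rfl⟩ := Submodule.mem_map.mp hw'
    set L : Matrix (Fin b) (Fin b) (MvPolynomial (Fin 1) ℂ) :=
      A.map (C : ℂ → MvPolynomial (Fin 1) ℂ) + (X 0 : MvPolynomial (Fin 1) ℂ) • w.map C with hL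
    have hsub : (Φ A).map (C : ℂ → MvPolynomial (Fin 1) ℂ) + (X 0 : MvPolynomial (Fin 1) ℂ) • (Φ w).map C = L.submatrix σ σ := by
      rw [hΦapp, hΦapp, hL]; rfl
    have hinvL : ∀ i j, (∀ a, σ a ≠ i) → (∃ c, σ c = j) → L i j = 0 := by
      intro i j hi hj
      rw [hL, Matrix.add_apply, Matrix.smul_apply, Matrix.map_apply, Matrix.map_apply, hinv A hA i j hi hj,
        hinv w (hWV hw) i j hi hj, map_zero, smul_zero, add_zero]
    rw [hsub, submatrix_pow_apply_of_invariant σ hσ L hinvL p a c]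
    exact hwin A hA w hw p hp (σ a) (σ c)
  have hmain := two_mul_sq_le_of_window_strictUpper hsn Vs hVs_iff Ws k hWsVs hwin_s
  have hcod := codim_map_le_of_le Φ V W hWV
  calc 2 * n * (s * s) ≤ (n * k + (Module.finrank ℂ Vs - Module.finrank ℂ Ws) + n + 2 * s) ^ 2 := hmain
    _ ≤ (n * k + (Module.finrank ℂ V - Module.finrank ℂ W) + n + 2 * s) ^ 2 := by
        apply Nat.pow_le_pow_left
        rw [hVs, hWs]
        omega

end Summit.ValiantsHypothesis.ValiantsHypothesis.Theorems.GrenetZeon.FreeTriangularPrice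

end
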